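import Summits.QuantumFields.YangMills.Theorems.FemtoTransferGapLevels
import Literature.Analysis.OperatorTheory.YangMillsMatrixModelDiscreteness
import HarnessLib

/-!
# Crux RED `RunningReduction`, line «KTR» rev 5, PART 5 §3b: `LevelGapSummable` — polynomial growth of Lüscher's
# invariant levels and Weyl-type summability `Σ_k e^{−sΔ_k} < ∞`

Support module (fleet service by seat ym-infvol-p1 g3; route owner ym-beyond-p1 g18 PROGRESS 2, ym-beyond bus
2026-08-27T05:40:24Z «TURNKEY for any idle prover (S): land §3b verbatim as
`Theorems/LuscherReductionRunningReductionLevelGapSummable.lean --supports stmt-QuantumFields-19978`»; scratch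
`pub/ym-beyond/p1-g18-files/LevelGapSummable-scratch.lean`) for crux `RunningReduction` (route `LuscherReduction`, item
stmt-QuantumFields-19978).  It discharges, on the Theorems side, the registered-then-proved-in-file stub
`TT.stub_levelGapSummable` of the skeleton `Lines-KTR-r5.lean` (sha16 1a44cddc0177accb): the conclusion of `levelGapSummable`
below is the body of `TT.LevelGapSummable` VERBATIM, so the skeleton's `levelGapSummable_holds` is
`fun s hs => LGS.levelGapSummable s hs`.

## Content (elementary, over tree objects only)
From the tree's quantitative Rellich count `le_physLevel_of_dimBound_lt` (`k > N(E) ⇒ μ_k ≥ E`,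
[SimonB1983DiscreteSpectrum, Cor. 4] as formalised in `Literature.Analysis.OperatorTheory.YangMillsMatrixModelDiscreteness`):
* `LGS.dimBound_eq` ∕ `LGS.dimBound_le` — Haar scaling of balls in `ZM = ℝ⁹` (`Measure.addHaar_closedBall`;
  `dim ZM = 9`) gives `N(E) = 8(R/ρ)⁹` with `R = 2(6E+4δ)`, `ρ = δ/2`, hence `N(E) ≤ 8·48⁹·(E+1)¹⁸`;
* `LGS.physLevel_succ_ge` — **polynomial growth of the invariant levels**: `μ_{k+1} ≥ ((k+1)/(16·48⁹))^{1/18} − 1`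
  (a quantitative by-product of the Simon-1983 layer, usable elsewhere);
* `LGS.exp_neg_le` — `e^{−sy} ≤ 36!/(sy)³⁶` (`x³⁶/36! ≤ eˣ`);
* `LGS.levelGapSummable` — **`Σ_k e^{−sΔ_k} < ∞` for every `s > 0`** (`Δ_k = levelGap k = μ_{k+1} − μ_1`), by comparison
  with `C(s)/(k+1)²`.

HONEST FRAMING: an elementary spectral-growth lemma for the 9-dimensional zero-momentum matrix model
`𝔥 = −½Δ + ¼Σ|x_i × x_j|²`; femto rung R2b1 bookkeeping only; nothing of the XL content of «KTR» (RG trace scaling,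
trace formula, dressed Ritz families); not infinite volume, not a mass gap, not Clay.
References: [cite: SimonB1983DiscreteSpectrum, Cor. 4]; [cite: Luscher1983, §3].
-/

set_option autoImplicit false

noncomputable section

open MeasureTheory Filter Topology Real
open Literature.Analysis.OperatorTheory.YMMatrixModel

namespace Summit.QuantumFields.YangMills.Theorems.FemtoTransferGap.LGS

/-- Haar scaling of closed balls in `ZM = ℝ⁹`: `vol B̄(0,r) = r⁹ · vol B(0,1)` (`dim ZM = 9` is the tree's
`FemtoTransferGap.finrank_ZM`, module `LuscherReductionOneSiteLevelsKacHeat`; re-derived inline here to keep the import cone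
small). [folklore] -/
theorem volume_closedBall_ZM {r : ℝ} (hr : 0 ≤ r) :
    volume (Metric.closedBall (0 : ZM) r) = ENNReal.ofReal (r ^ 9) * volume (Metric.ball (0 : ZM) 1) := by
  rw [Measure.addHaar_closedBall volume (0 : ZM) hr, finrank_euclideanSpace, Fintype.card_prod, Fintype.card_fin]

/-- The unit ball of `ZM` has positive finite volume. [folklore] -/
theorem unitBall_toReal_pos : 0 < (volume (Metric.ball (0 : ZM) 1)).toReal :=
  ENNReal.toReal_pos (Metric.measure_ball_pos volume (0 : ZM) one_pos).ne' (measure_ball_lt_top).ne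

/-- The explicit Rellich count in closed form: `N(E) = 8 (R/ρ)⁹` with `R = 2(6E+4δ)`, `ρ = δ/2`, `δ = mollScale E`.
[cite: SimonB1983DiscreteSpectrum, Cor. 4] -/
theorem dimBound_eq (E : ℝ) (hE : 0 ≤ E) :
    dimBound E = 8 * ((2 * (6 * E + 4 * mollScale E)) ^ 9 / (mollScale E / 2) ^ 9) := by
  have hδ := mollScale_pos E
  have hρ : 0 ≤ mollScale E / 2 := by positivity
  have hR : 0 ≤ 2 * (6 * E + 4 * mollScale E) := by positivity
  have v1 := unitBall_toReal_pos
  unfold dimBound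
  rw [measureReal_def, volume_closedBall_ZM hρ, volume_closedBall_ZM hR, ENNReal.toReal_mul, ENNReal.toReal_mul,
    ENNReal.toReal_ofReal (by positivity), ENNReal.toReal_ofReal (by positivity)]
  have hρ9 : 0 < (mollScale E / 2) ^ 9 := by positivity
  field_simp
  ring

/-- Polynomial bound on the Rellich count: `R/ρ ≤ 48 (E+1)²`, i.e. `N(E) ≤ 8·48⁹·(E+1)¹⁸`.
[cite: SimonB1983DiscreteSpectrum, Cor. 4] -/
theorem dimBound_le (E : ℝ) (hE : 0 ≤ E) : dimBound E ≤ 8 * 48 ^ 9 * (E + 1) ^ 18 := by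
  rw [dimBound_eq E hE]
  have hδ := mollScale_pos E
  have hs0 : 0 ≤ Real.sqrt (2 * E) := Real.sqrt_nonneg _
  have hsq : Real.sqrt (2 * E) ≤ E + 1 := by
    rw [Real.sqrt_le_left (by linarith)]
    nlinarith
  -- R/ρ = 4(6E+4δ)/δ = 24E/δ + 16, and 1/δ = 2(√(2E)+1)
  have hratio : 2 * (6 * E + 4 * mollScale E) / (mollScale E / 2) = 48 * E * (Real.sqrt (2 * E) + 1) + 16 := by
    unfold mollScale at *
    field_simp
    ring
  have hratio_le : 2 * (6 * E + 4 * mollScale E) / (mollScale E / 2) ≤ 48 * (E + 1) ^ 2 := by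
    rw [hratio]; nlinarith
  have hratio_nn : 0 ≤ 2 * (6 * E + 4 * mollScale E) / (mollScale E / 2) := by positivity
  calc 8 * ((2 * (6 * E + 4 * mollScale E)) ^ 9 / (mollScale E / 2) ^ 9)
      = 8 * (2 * (6 * E + 4 * mollScale E) / (mollScale E / 2)) ^ 9 := by rw [← div_pow]
    _ ≤ 8 * (48 * (E + 1) ^ 2) ^ 9 := by gcongr
    _ = 8 * 48 ^ 9 * (E + 1) ^ 18 := by ring

/-- **Polynomial growth of Lüscher's invariant levels**: `μ_{k+1} ≥ ((k+1)/A)^{1/18} − 1` with the growth constant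
`A = 16·48⁹` (from `dimBound_le` and the tree's `le_physLevel_of_dimBound_lt`). [cite: SimonB1983DiscreteSpectrum, Cor. 4] -/
theorem physLevel_succ_ge (k : ℕ) :
    (((k : ℝ) + 1) / (16 * 48 ^ 9)) ^ ((18 : ℝ)⁻¹) - 1 ≤ physLevel (k + 1) := by
  set E : ℝ := (((k : ℝ) + 1) / (16 * 48 ^ 9)) ^ ((18 : ℝ)⁻¹) - 1 with hEdef
  by_cases hE : 0 ≤ E
  · refine le_physLevel_of_dimBound_lt hE ?_
    have hx : 0 ≤ ((k : ℝ) + 1) / (16 * 48 ^ 9) := by positivity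
    have h18 : (E + 1) ^ 18 = ((k : ℝ) + 1) / (16 * 48 ^ 9) := by
      have : E + 1 = (((k : ℝ) + 1) / (16 * 48 ^ 9)) ^ ((18 : ℝ)⁻¹) := by rw [hEdef]; ring
      rw [this]
      exact_mod_cast Real.rpow_inv_natCast_pow hx (by norm_num : (18 : ℕ) ≠ 0)
    calc dimBound E ≤ 8 * 48 ^ 9 * (E + 1) ^ 18 := dimBound_le E hE
      _ = ((k : ℝ) + 1) / 2 := by rw [h18]; field_simp; ring
      _ < ((k + 1 : ℕ) : ℝ) := by push_cast; linarith
  · push Not at hE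
    exact hE.le.trans (physLevel_nonneg (by omega))

/-- Stretched-exponential domination: `e^{−sy} ≤ 36!/(sy)³⁶` for `s, y > 0` (from `x³⁶/36! ≤ eˣ`). [folklore] -/
theorem exp_neg_le (s y : ℝ) (hs : 0 < s) (hy : 0 < y) :
    Real.exp (-(s * y)) ≤ (Nat.factorial 36 : ℝ) / ((s * y) ^ 36) := by
  have hsy : 0 < s * y := mul_pos hs hy
  have h := Real.pow_div_factorial_le_exp (s * y) (n := 36) hsy.le
  rw [Real.exp_neg, inv_eq_one_div, div_le_div_iff₀ (Real.exp_pos _) (by positivity)]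
  have hf : (0 : ℝ) < Nat.factorial 36 := by exact_mod_cast Nat.factorial_pos 36
  rw [div_le_iff₀ hf] at h
  linarith

/-- **`LevelGapSummable`** (body of `TT.LevelGapSummable` of the «KTR» rev-5 skeleton, verbatim): `Σ_k e^{−sΔ_k} < ∞` for
every `s > 0`, where `Δ_k = levelGap k = μ_{k+1} − μ_1`.  Proof: `physLevel_succ_ge` gives `μ_{k+1} ≥ y_k − 1` with
`y_k = ((k+1)/A)^{1/18}`, `exp_neg_le` gives `e^{−s y_k} ≤ 36!/(s y_k)³⁶ = (36!·A²/s³⁶)/(k+1)²`, and `Σ 1/(k+1)² < ∞`.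
[cite: SimonB1983DiscreteSpectrum, Cor. 4] -/
theorem levelGapSummable (s : ℝ) (hs : 0 < s) : Summable fun k : ℕ => Real.exp (-s * levelGap k) := by
  have hA : (0 : ℝ) < 16 * 48 ^ 9 := by positivity
  -- comparison series: C / (k+1)^2
  set C : ℝ := Real.exp (s * (physLevel 1 + 1)) * ((Nat.factorial 36 : ℝ) * (16 * 48 ^ 9) ^ 2 / s ^ 36) with hC
  have hsum : Summable fun k : ℕ => C * (1 / ((k : ℝ) + 1) ^ 2) := by
    refine Summable.mul_left C ?_
    have h := (summable_nat_add_iff 1).mpr (Real.summable_one_div_nat_pow.mpr one_lt_two)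
    simpa [Nat.cast_add, Nat.cast_one] using h
  refine Summable.of_nonneg_of_le (fun k => (Real.exp_pos _).le) (fun k => ?_) hsum
  -- y_k := ((k+1)/A)^{1/18} > 0, with y^36 = ((k+1)/A)^2
  set x : ℝ := ((k : ℝ) + 1) / (16 * 48 ^ 9) with hx
  have hxpos : 0 < x := by positivity
  set y : ℝ := x ^ ((18 : ℝ)⁻¹) with hy
  have hypos : 0 < y := Real.rpow_pos_of_pos hxpos _
  have hy18 : y ^ 18 = x := by
    rw [hy]; exact_mod_cast Real.rpow_inv_natCast_pow hxpos.le (by norm_num : (18 : ℕ) ≠ 0)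
  have hy36 : y ^ 36 = x ^ 2 := by rw [show (36 : ℕ) = 18 * 2 by norm_num, pow_mul, hy18]
  have hlev : y - 1 ≤ physLevel (k + 1) := physLevel_succ_ge k
  -- exp(-s Δ_k) = exp(-s μ_{k+1}) · exp(s μ_1) ≤ exp(s(μ_1+1)) · exp(-s y)
  have h1 : Real.exp (-s * levelGap k) ≤ Real.exp (s * (physLevel 1 + 1)) * Real.exp (-(s * y)) := by
    rw [← Real.exp_add]
    apply Real.exp_le_exp.mpr
    unfold levelGap
    nlinarith
  have h2 : Real.exp (-(s * y)) ≤ (Nat.factorial 36 : ℝ) / ((s * y) ^ 36) := exp_neg_le s y hs hypos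
  have h3 : (Nat.factorial 36 : ℝ) / ((s * y) ^ 36) =
      ((Nat.factorial 36 : ℝ) * (16 * 48 ^ 9) ^ 2 / s ^ 36) * (1 / ((k : ℝ) + 1) ^ 2) := by
    rw [mul_pow, hy36, hx]
    field_simp
  calc Real.exp (-s * levelGap k)
      ≤ Real.exp (s * (physLevel 1 + 1)) * Real.exp (-(s * y)) := h1
    _ ≤ Real.exp (s * (physLevel 1 + 1)) * ((Nat.factorial 36 : ℝ) / ((s * y) ^ 36)) := by
        gcongr
    _ = C * (1 / ((k : ℝ) + 1) ^ 2) := by rw [h3, hC]; ring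

/-- **`LevelGapSummable` in closed form** (the `∀ s > 0` statement, i.e. `TT.LevelGapSummable` itself, by name-free body):
`∀ s > 0, Summable (k ↦ e^{−sΔ_k})`. [cite: SimonB1983DiscreteSpectrum, Cor. 4] -/
theorem levelGapSummable_all : ∀ s : ℝ, 0 < s → Summable fun k : ℕ => Real.exp (-s * levelGap k) :=
  fun s hs => levelGapSummable s hs

end Summit.QuantumFields.YangMills.Theorems.FemtoTransferGap.LGS

end
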